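import Summits.QuantumFields.YangMills.Theorems.ConvexGribovBodyCovarianceBoundStubSupMeasurable
import HarnessLib

/-!
# Crux `ConvexGribovBody.CovarianceBound` (stmt-QuantumFields-8780) — strategist r1 (second opinion),
# typed companions of STRATEGY-CENSUS gen 2 (2026-08-17)

Nothing here restates or weakens the crux; nothing is asserted. Three kernel-checked items, each the Lean
face of one census heading:

* §1 STRENGTHEN (census S13). `ExpMomentBound` — the exponential-moment / pressure form of the crux
  ("the law of the minimal-Coulomb-gauge mode covariance has a volume-uniform exponential moment") and
  `covarianceBound_of_expMomentBound : ExpMomentBound → CovarianceBound` (Jensen in the form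
  `t x ≤ e^{t x} − 1`). It is what a chessboard / reflection-positivity estimate in the time direction
  would have to feed (census S13), and it is ≥ the crux: no leverage, recorded so that nobody types it again.
* §2 DECOMPOSITION (census D10). `mass_le_incoherence_add_slow` — the abstract spectral inequality behind
  the slow/fast split in the TIME direction: for weights `w ≥ 0` on eigenvalues `λ ∈ [0,1]` of a positive
  transfer operator, `Σ w ≤ δ⁻¹ Σ w(1−λ) + Σ_{λ > 1−δ} w`. Dictionary (docstring): `Σ w = cov(p)`,
  `Σ w(1−λ) = ½L⁻³ E‖X_p(1) − X_p(0)‖²` (one-step incoherence), slow part = spectral weight of the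
  gauge-fixed mode below energy `δ`. Both pieces are ≤ the crux (unlike the gap-pincer D3, whose first piece
  is the route's target); the slow piece is the toron-suppression heart; the dictionary needs the Wilson
  transfer operator's spectral measure, which is not a tree notion — so the split is NOT filed.
* §3 NEGATION / PLACEMENT (census N-e′). `not_covarianceBound_of_floor` — any admissible `(G, r)` whose
  averaged lowest-mode covariance has a DIVERGENT floor `f(S) → ∞` on arbitrarily large tori at arbitrarily
  weak coupling refutes the crux. Typed form of "every proof must exclude a gauge-fixed massless (Coulomb)
  phase at every large β for every compact simple G and every faithful r" — the linear floor `f(S) = c(2S+1)`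
  is realised by the `U(1)₄` Coulomb phase (Disproof §C `covBody_U1_false`, near-miss) and, at FIXED `S` as
  `β → ∞`, by the spread torons (Disproof §A′ `toron_tight`; `FemtoToronFloor`).

Vocabulary: `…Cruxes.CovarianceBound.SupportWindow` (`supCov`, `wilson4`, `covarianceBound_iff`,
`stub_supMeasurable`), Theorems/ConvexGribovBodyCovarianceBoundDefs + …StubSupMeasurable.
-/

set_option autoImplicit false

noncomputable section

namespace Summit.QuantumFields.YangMills.Cruxes.CovarianceBound.StrategistR1

open scoped BigOperators
open MeasureTheory Filter
open Literature.MathematicalPhysics.QuantumFieldTheory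
open Summit.QuantumFields.YangMills.Cruxes.CovarianceBound.SupportWindow
open Summit.QuantumFields.YangMills.Theses.ConvexGribovBody (CovarianceBound)

/-! ## §1 Strengthen: the exponential-moment (pressure) form -/

/-- **S13 `ExpMomentBound`** (≥ crux; census gen 2 §4): for every compact simple `G` and faithful `r`
there is `β₀` such that for every `β ≥ β₀` there are `t > 0`, `D` and `S₀` with
`E_{μ_β} exp(t · supCov_p) ≤ exp(t D)` on every torus `S ≥ S₀` and every momentum `p` — a volume-uniform
exponential moment of the crux's integrand (the single-slice shadow of the time-direction pressure bound
`L⁻¹ log E exp(t Σ_t supCov_p(slice t)) ≤ tD` that a chessboard estimate would produce). -/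
def ExpMomentBound : Prop :=
  ∀ (G : Type) [Group G] [TopologicalSpace G] [IsTopologicalGroup G] [CompactSpace G]
    [MeasurableSpace G] [BorelSpace G], IsCompactSimpleLieGroup G →
    ∀ r : LatticeRep G, ∃ β₀ : ℝ, ∀ β : ℝ, β₀ ≤ β → ∃ t : ℝ, 0 < t ∧ ∃ D : ℝ, 0 < D ∧ ∃ S₀ : ℕ,
      ∀ S : ℕ, S₀ ≤ S → ∀ p : Fin 3 → ZMod (2 * S + 1),
        ∫ U, Real.exp (t * supCov r S p U) ∂(wilson4 r β S) ≤ Real.exp (t * D)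

/-- Jensen in its cheapest form: `ExpMomentBound → CovarianceBound` with `D' = (e^{tD} − 1)/t + 1`
(pointwise `t x ≤ e^{t x} − 1`, integrate; `supCov` is bounded and Borel by `stub_supMeasurable`). -/
theorem covarianceBound_of_expMomentBound : ExpMomentBound → CovarianceBound := by
  intro hE
  rw [covarianceBound_iff]
  intro G _ _ _ _ _ _ hG r
  obtain ⟨β₀, hβ₀⟩ := hE G hG r
  refine ⟨β₀, fun β hβ => ?_⟩
  obtain ⟨t, ht, D, hD, S₀, hS₀⟩ := hβ₀ β hβ
  refine ⟨(Real.exp (t * D) - 1) / t + 1, ?_, S₀, fun S hS p => ?_⟩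
  · have h1 : 0 ≤ (Real.exp (t * D) - 1) / t := by
      apply div_nonneg _ ht.le
      have : 1 ≤ Real.exp (t * D) := Real.one_le_exp (by positivity)
      linarith
    linarith
  · have hmain := hS₀ S hS p
    -- measurability and bounds of the integrand
    obtain ⟨-, -, hmeas, -, -, hbnd⟩ := stub_supMeasurable G r S p 0
    set μ : Measure (GaugeConfig 4 (2 * S + 1) G) := wilson4 r β S with hμ
    have hprob : IsProbabilityMeasure μ := by rw [hμ]; infer_instance
    set M : ℝ := 3 * r.N * (2 * S + 1 : ℝ) ^ 3 with hM
    have hb : ∀ U, 0 ≤ supCov r S p U ∧ supCov r S p U ≤ M := fun U => (hbnd U).1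
    -- integrability of supCov and of exp (t * supCov)
    have hint1 : Integrable (fun U => supCov r S p U) μ := by
      refine Integrable.mono' (integrable_const M) hmeas.aestronglyMeasurable ?_
      refine Filter.Eventually.of_forall fun U => ?_
      rw [Real.norm_eq_abs, abs_of_nonneg (hb U).1]
      exact (hb U).2
    have hmeas2 : Measurable fun U => Real.exp (t * supCov r S p U) :=
      Real.measurable_exp.comp (hmeas.const_mul t)
    have hint2 : Integrable (fun U => Real.exp (t * supCov r S p U)) μ := by
      refine Integrable.mono' (integrable_const (Real.exp (t * M))) hmeas2.aestronglyMeasurable ?_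
      refine Filter.Eventually.of_forall fun U => ?_
      rw [Real.norm_eq_abs, abs_of_nonneg (Real.exp_pos _).le]
      exact Real.exp_le_exp.2 (mul_le_mul_of_nonneg_left (hb U).2 ht.le)
    -- pointwise Jensen: supCov ≤ (exp (t supCov) - 1)/t
    have hpt : ∀ U, supCov r S p U ≤ (Real.exp (t * supCov r S p U) - 1) / t := by
      intro U
      rw [le_div_iff₀ ht]
      have := Real.add_one_le_exp (t * supCov r S p U)
      linarith [mul_comm (supCov r S p U) t]
    have hint3 : Integrable (fun U => (Real.exp (t * supCov r S p U) - 1) / t) μ :=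
      ((hint2.sub (integrable_const 1)).div_const t)
    calc ∫ U, supCov r S p U ∂(wilsonMeasure (d := 4) (L := 2 * S + 1) r.ρ β)
        = ∫ U, supCov r S p U ∂μ := by rw [hμ]; rfl
      _ ≤ ∫ U, (Real.exp (t * supCov r S p U) - 1) / t ∂μ :=
          integral_mono hint1 hint3 fun U => hpt U
      _ = ((∫ U, Real.exp (t * supCov r S p U) ∂μ) - 1) / t := by
          rw [integral_div, integral_sub hint2 (integrable_const 1)]
          simp [integral_const]
      _ ≤ (Real.exp (t * D) - 1) / t := by
          apply div_le_div_of_nonneg_right _ ht.le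
          have : ∫ U, Real.exp (t * supCov r S p U) ∂μ ≤ Real.exp (t * D) := by
            rw [hμ]; exact hmain
          linarith
      _ ≤ (Real.exp (t * D) - 1) / t + 1 := by linarith

/-! ## §2 Decomposition: the abstract slow/fast spectral split in the time direction -/

/-- **D10, abstract form.** Weights `w i ≥ 0` carried by eigenvalues `λ i ≤ 1` (for a positive transfer operator `λ i ∈ [0,1]`; only the upper bound is used) (dictionary: `w i` =
`L⁻³ |⟨i | X_p Ω⟩|²` in an eigenbasis of Wilson's positive transfer operator, so `Σ w = cov(p)`,
`Σ w (1 − λ) = ½ L⁻³ E‖X_p(slice 1) − X_p(slice 0)‖²` = one-step incoherence, and the filtered sum = the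
spectral weight of the gauge-fixed mode below energy `δ`): total mass ≤ `δ⁻¹ ×` incoherence `+` slow weight.
So `cov(p) ≤ D` follows from a volume-uniform one-step incoherence bound AND a volume-uniform slow-weight
bound — both CONSEQUENCES of the crux (honest pieces), the second being the toron-suppression heart. -/
theorem mass_le_incoherence_add_slow {ι : Type*} (s : Finset ι) (w lam : ι → ℝ) (δ : ℝ)
    (hδ : 0 < δ) (hw : ∀ i ∈ s, 0 ≤ w i) (hl1 : ∀ i ∈ s, lam i ≤ 1) :
    ∑ i ∈ s, w i ≤
      (1 / δ) * ∑ i ∈ s, w i * (1 - lam i) + ∑ i ∈ s.filter (fun i => 1 - δ < lam i), w i := by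
  classical
  have hsplit := Finset.sum_filter_add_sum_filter_not s (fun i => 1 - δ < lam i) w
  -- fast part: on `λ ≤ 1 - δ`, `w ≤ δ⁻¹ w (1 - λ)`
  have hfast : ∑ i ∈ s.filter (fun i => ¬ (1 - δ < lam i)), w i ≤
      (1 / δ) * ∑ i ∈ s.filter (fun i => ¬ (1 - δ < lam i)), w i * (1 - lam i) := by
    rw [Finset.mul_sum]
    refine Finset.sum_le_sum fun i hi => ?_
    rw [Finset.mem_filter] at hi
    obtain ⟨his, hnot⟩ := hi
    have hle : δ ≤ 1 - lam i := by linarith [not_lt.1 hnot]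
    have hw' := hw i his
    rw [one_div, ← div_eq_inv_mul, le_div_iff₀ hδ]
    calc w i * δ ≤ w i * (1 - lam i) := mul_le_mul_of_nonneg_left hle hw'
      _ = w i * (1 - lam i) := rfl
  -- the `δ⁻¹`-weighted sum over the fast part is ≤ the one over all of `s` (nonnegative terms)
  have hmono : ∑ i ∈ s.filter (fun i => ¬ (1 - δ < lam i)), w i * (1 - lam i) ≤
      ∑ i ∈ s, w i * (1 - lam i) := by
    refine Finset.sum_le_sum_of_subset_of_nonneg (Finset.filter_subset _ _) fun i hi _ => ?_
    exact mul_nonneg (hw i hi) (by linarith [hl1 i hi])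
  have hδ' : 0 ≤ 1 / δ := by positivity
  calc ∑ i ∈ s, w i
      = ∑ i ∈ s.filter (fun i => 1 - δ < lam i), w i +
          ∑ i ∈ s.filter (fun i => ¬ (1 - δ < lam i)), w i := hsplit.symm
    _ ≤ ∑ i ∈ s.filter (fun i => 1 - δ < lam i), w i +
          (1 / δ) * ∑ i ∈ s.filter (fun i => ¬ (1 - δ < lam i)), w i * (1 - lam i) := by
        linarith [hfast]
    _ ≤ ∑ i ∈ s.filter (fun i => 1 - δ < lam i), w i + (1 / δ) * ∑ i ∈ s, w i * (1 - lam i) := by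
        have := mul_le_mul_of_nonneg_left hmono hδ'
        linarith
    _ = (1 / δ) * ∑ i ∈ s, w i * (1 - lam i) + ∑ i ∈ s.filter (fun i => 1 - δ < lam i), w i := by
        ring

/-! ## §3 Negation / placement: a divergent infrared floor at arbitrarily weak coupling refutes the crux -/

/-- **N-e′ (placement).** If some admissible `(G, r)` has, at arbitrarily large `β`, on arbitrarily large
tori, a momentum whose averaged minimal-Coulomb-gauge covariance is at least `f(S)` with `f → ∞`, then
`CovarianceBound` fails. With `f(S) = c (2S+1)` this is the signature of a gauge-fixed MASSLESS (Coulomb)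
phase (free slice field: `cov(p_min) = g²L/(4π)`; `U(1)₄`: Disproof §C) and of toron dominance (femto
regime, Disproof §A′): every proof of the crux must exclude both at every large `β`, for every compact
simple `G` and every faithful `r` — a weak-coupling, volume-uniform confinement-type statement. -/
theorem not_covarianceBound_of_floor {G : Type} [Group G] [TopologicalSpace G] [IsTopologicalGroup G]
    [CompactSpace G] [MeasurableSpace G] [BorelSpace G] (hG : IsCompactSimpleLieGroup G)
    (r : LatticeRep G) (f : ℕ → ℝ) (hf : Tendsto f atTop atTop)
    (hfloor : ∀ β₀ : ℝ, ∃ β : ℝ, β₀ ≤ β ∧ ∀ S₀ : ℕ, ∃ S : ℕ, S₀ ≤ S ∧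
      ∃ p : Fin 3 → ZMod (2 * S + 1), f S ≤ ∫ U, supCov r S p U ∂(wilson4 r β S)) :
    ¬ CovarianceBound := by
  intro hC
  rw [covarianceBound_iff] at hC
  obtain ⟨β₀, hβ₀⟩ := hC G hG r
  obtain ⟨β, hβ, hβfloor⟩ := hfloor β₀
  obtain ⟨D, -, S₀, hS₀⟩ := hβ₀ β hβ
  -- `f S > D` eventually
  obtain ⟨S₁, hS₁⟩ : ∃ S₁ : ℕ, ∀ S, S₁ ≤ S → D + 1 ≤ f S := by
    have h := (Filter.tendsto_atTop.1 hf) (D + 1)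
    rw [Filter.eventually_atTop] at h
    exact h
  obtain ⟨S, hS, p, hp⟩ := hβfloor (max S₀ S₁)
  have h1 : f S ≤ D := by
    refine le_trans hp ?_
    have := hS₀ S (le_trans (le_max_left _ _) hS) p
    exact this
  have h2 : D + 1 ≤ f S := hS₁ S (le_trans (le_max_right _ _) hS)
  linarith

end Summit.QuantumFields.YangMills.Cruxes.CovarianceBound.StrategistR1

end
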